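import Literature.Computability.Complexity.MajorityVote
import HarnessLib

/-!
# Two-sided weak law of large numbers over a finite uniform sample space (counting form)

Trunk T-CPLX-CORE, companion of `MajorityVote.lean` (which proves the ONE-sided "majority
fails" bound `card_majority_fail_mul_le` by the same method). Here: for `m ≥ 1` independent
uniform trials with outcomes in a finite nonempty `α` and an event `good ⊆ α` of density
`p = #good/|α|`, the outcome sequences whose number of good trials deviates from `m·p` by at
least `m·η` (`η > 0`) number at most `|α|^m / (4 m η²)` (`card_deviation_mul_le`; Chebyshev:
mean `m p`, variance `≤ m/4`). This is the estimate behind "estimate, using random sampling and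
membership queries to `f`, the agreement between `f` and each produced circuit" in the NW
reconstruction algorithm (Carmosino–Impagliazzo–Kabanets–Kolokolova 2016, Thm. 2.11) and behind
hypothesis testing by a learner; written for the decomposition of
`Literature.Computability.Learning.cikk_natural_implies_learning`, but independent of it.

Proof: as in `MajorityVote.lean` — Mathlib's Chebyshev inequality
`ProbabilityTheory.meas_ge_le_variance_div_sq` under the product of uniform measures
(`uniformOn_pi`), `variance_sum_pi`, Bhatia–Davis `variance_le_sub_mul_sub`; the statement is
pure counting.

## References

* E. Kranakis, *Primality and Cryptography*, Wiley–Teubner 1986, §3.5, Thm. 3.5 (Weak Law of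
  Large Numbers, Bernoulli case: `Pr[|F_n(E) - p| ≥ ε] ≤ p(1-p)/(nε²) ≤ 1/(4nε²)`)
  [Kranakis1986].
* S. Arora, B. Barak, *Computational Complexity: A Modern Approach*, CUP 2009, Lemma A.12
  (Chebyshev) [AroraBarak2009].
* M. Carmosino, R. Impagliazzo, V. Kabanets, A. Kolokolova, *Learning algorithms from natural
  proofs*, CCC 2016, Thm. 2.11 (sampling step) [CarmosinoImpagliazzoKabanetsKolokolova2016].
-/

noncomputable section

namespace Literature.Computability.Complexity

open MeasureTheory ProbabilityTheory Finset

/-- **Weak law of large numbers, two-sided, counting version.** Let `α` be a finite nonempty set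
of outcomes of one trial and `good` an event of density `p = #good / |α|`. Among the `|α|^m`
outcome sequences of `m ≥ 1` independent uniform trials, those in which the number of good
trials deviates from `m p` by at least `m η` (`η > 0`) number at most `|α|^m / (4 m η²)`
(Kranakis, Thm. 3.5: `Pr[|F_n(E) - p| ≥ ε] ≤ 1/(4nε²)`). [cite: Kranakis1986, Thm. 3.5] -/
theorem card_deviation_mul_le {α : Type*} [Fintype α] [Nonempty α]
    (good : α → Prop) [DecidablePred good] {m : ℕ} (hm : 0 < m) {η : ℝ} (hη : 0 < η) :
    ((univ.filter fun ω : Fin m → α => (m : ℝ) * η ≤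
        |((univ.filter fun i => good (ω i)).card : ℝ) -
          m * ((univ.filter good).card / Fintype.card α)|).card : ℝ)
        * (4 * m * η ^ 2) ≤ Fintype.card (Fin m → α) := by
  classical
  letI : MeasurableSpace α := ⊤
  haveI : MeasurableSingletonClass α := ⟨fun _ => MeasurableSpace.measurableSet_top⟩
  -- one trial: the uniform measure on `α`, and the indicator `X` of a good outcome
  set μ : Measure α := uniformOn (Set.univ : Set α) with hμ
  set X : α → ℝ := fun a => if good a then 1 else 0 with hX
  have hXmeas : Measurable X := measurable_of_finite X
  have hXbdd : ∀ᵐ a ∂μ, X a ∈ Set.Icc (0 : ℝ) 1 :=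
    ae_of_all _ fun a => by simp only [hX]; split_ifs <;> simp
  have hXLp : MemLp X 2 μ := memLp_of_bounded hXbdd hXmeas.aestronglyMeasurable 2
  set p : ℝ := (univ.filter good).card / Fintype.card α with hp
  -- its mean is the good fraction `p`
  have hmean : μ[X] = p := by
    have hcard : (0 : ℝ) < Fintype.card α := by exact_mod_cast Fintype.card_pos
    rw [integral_fintype (MemLp.integrable (by norm_num) hXLp)]
    have hsing : ∀ a : α, μ.real {a} = (Fintype.card α : ℝ)⁻¹ := fun a => by
      rw [measureReal_def, hμ, uniformOn_univ, Measure.count_singleton]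
      simp [ENNReal.toReal_inv]
    simp only [hsing, smul_eq_mul, ← Finset.mul_sum]
    rw [show ∑ a : α, X a = ((univ.filter good).card : ℝ) by
      rw [Finset.natCast_card_filter]]
    rw [inv_mul_eq_div, hp]
  -- its variance is at most `1/4`
  have hvar : Var[X; μ] ≤ 1 / 4 := by
    have h := variance_le_sub_mul_sub hXbdd hXmeas.aemeasurable
    nlinarith [h, sq_nonneg (μ[X] - 1 / 2)]
  -- `m` independent trials: the product measure, and the number `S` of good trials
  set P : Measure (Fin m → α) := Measure.pi fun _ : Fin m => μ with hP
  have hPunif : uniformOn (Set.univ : Set (Fin m → α)) = P := by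
    rw [hP, ← uniformOn_pi, Set.pi_univ]
  set S : (Fin m → α) → ℝ := ∑ i : Fin m, fun ω => X (ω i) with hS
  have hSLp : MemLp S 2 P := by
    refine memLp_finsetSum' _ fun i _ => ?_
    exact hXLp.comp_measurePreserving (measurePreserving_eval (fun _ : Fin m => μ) i)
  have hSvar : Var[S; P] ≤ m / 4 := by
    rw [hS, hP, variance_sum_pi fun _ => hXLp]
    calc ∑ _i : Fin m, Var[X; μ] ≤ ∑ _i : Fin m, (1 / 4 : ℝ) := Finset.sum_le_sum fun i _ => hvar
      _ = m / 4 := by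
          simp only [Finset.sum_const, Finset.card_univ, Fintype.card_fin]; ring
  have hSmean : P[S] = (m : ℝ) * p := by
    have hint : ∀ i : Fin m, ∫ ω, X (ω i) ∂P = μ[X] := fun i => by
      have hmp := measurePreserving_eval (fun _ : Fin m => μ) i
      rw [← hmp.map_eq, integral_map (measurable_pi_apply i).aemeasurable
        hXmeas.aestronglyMeasurable]
    have : P[S] = ∑ i : Fin m, ∫ ω, X (ω i) ∂P := by
      rw [hS, ← integral_finsetSum _ fun i _ => ?_]
      · simp only [Finset.sum_apply]
      · exact MemLp.integrable (by norm_num)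
          (hXLp.comp_measurePreserving (measurePreserving_eval (fun _ : Fin m => μ) i))
    rw [this]
    simp only [hint, hmean, Finset.sum_const, Finset.card_univ, Fintype.card_fin, nsmul_eq_mul]
  -- the deviation event IS the Chebyshev tail `{m η ≤ |S - E S|}`
  set B : Finset (Fin m → α) := univ.filter fun ω : Fin m → α => (m : ℝ) * η ≤
    |((univ.filter fun i => good (ω i)).card : ℝ) - m * p| with hB
  have hSval : ∀ ω, S ω = ((univ.filter fun i => good (ω i)).card : ℝ) := fun ω => by
    rw [hS, Finset.natCast_card_filter, Finset.sum_apply]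
  have hsub : (B : Set (Fin m → α)) ⊆ {ω | (m : ℝ) * η ≤ |S ω - P[S]|} := by
    intro ω hω
    rw [Finset.mem_coe, hB, Finset.mem_filter] at hω
    rw [Set.mem_setOf_eq, hSval ω, hSmean]
    exact hω.2
  have hcheb := meas_ge_le_variance_div_sq hSLp (c := (m : ℝ) * η) (by positivity)
  have hPB : P B ≤ ENNReal.ofReal (1 / (4 * m * η ^ 2)) := by
    refine ((measure_mono hsub).trans hcheb).trans (ENNReal.ofReal_le_ofReal ?_)
    rw [div_le_div_iff₀ (by positivity) (by positivity)]
    have hm' : (1 : ℝ) ≤ m := by exact_mod_cast hm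
    nlinarith [hSvar, sq_nonneg η, mul_pos (show (0:ℝ) < m by positivity) (sq_pos_of_pos hη)]
  -- read the product measure of `B` as a proportion
  have hPB' : P B = (B.card : ENNReal) / Fintype.card (Fin m → α) := by
    rw [← hPunif, uniformOn_univ, Measure.count_apply_finset]
  rw [hPB'] at hPB
  have hN : (0 : ℝ) < Fintype.card (Fin m → α) := by exact_mod_cast Fintype.card_pos
  have hreal : (B.card : ℝ) / Fintype.card (Fin m → α) ≤ 1 / (4 * m * η ^ 2) := by
    have := ENNReal.toReal_mono ENNReal.ofReal_ne_top hPB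
    rwa [ENNReal.toReal_div, ENNReal.toReal_ofReal (by positivity), ENNReal.toReal_natCast,
      ENNReal.toReal_natCast] at this
  rw [div_le_div_iff₀ hN (by positivity), one_mul] at hreal
  exact hreal

/-- **Two-sided weak law, fraction form**: the deviant sequences number at most
`|α|^m / (4 m η²)`. [cite: Kranakis1986, Thm. 3.5] -/
theorem card_deviation_le {α : Type*} [Fintype α] [Nonempty α]
    (good : α → Prop) [DecidablePred good] {m : ℕ} (hm : 0 < m) {η : ℝ} (hη : 0 < η) :
    ((univ.filter fun ω : Fin m → α => (m : ℝ) * η ≤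
        |((univ.filter fun i => good (ω i)).card : ℝ) -
          m * ((univ.filter good).card / Fintype.card α)|).card : ℝ) ≤
      Fintype.card (Fin m → α) / (4 * m * η ^ 2) := by
  rw [le_div_iff₀ (by positivity)]
  exact card_deviation_mul_le good hm hη

end Literature.Computability.Complexity
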